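import Mathlib.Geometry.Manifold.IntegralCurve.Basic
import Mathlib.Geometry.Manifold.LocalDiffeomorph
import Mathlib.Analysis.Convex.Deriv
import Mathlib.Analysis.SpecialFunctions.ExpDeriv
import Mathlib.MeasureTheory.Integral.IntervalIntegral.FundThmCalculus
import Literature.Geometry.Lorentzian.SelfSimilarVacuumProfile
import Literature.Geometry.Lorentzian.HawkingMassFlux
import Literature.Geometry.Lorentzian.CoordinateFrames
import Literature.Geometry.Lorentzian.HypersurfaceRestriction
import HarnessLib

/-!
# Generator kinematics of a null hypersurface presented as a regular level set
# (definition request `defn-NullConeGeneratorKinematics`, route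
# FinalStateConjecture/HomotheticSurfaceGravity: items HomotheticSurfaceGravityLaw,
# BenignProfileRigidity, TransversalExponentLadder)

A **null hypersurface given as a regular level set** of a `C^n` Lorentzian manifold `(M, g)`,
`n ≥ 1` (Levi-Civita connection from `LeviCivitaProofs.lean`): `𝒩 = {v = 0}` with `v` smooth
near `𝒩` and `ker dv_x = L^⊥` for a null vector `L` at each `x ∈ 𝒩` — exactly the shape of the
vertex past cone `SelfSimilarVacuumProfile.cone` (`SelfSimilarVacuumProfile.coneLevelSet` is the
bridge, `coneLevelSet_carrier : _ = Z.cone` by `rfl`). This file provides the vocabulary of the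
**kinematics of its null generators**:

* `LorentzianMetric.NullLevelSet g` (the hypothesis structure; `carrier`, `mfderiv_fn_ne_zero`,
  `isNull_of_ker_iff`: a vector with `v^⊥ = ker dv` is null), its image `map Φ` under a homothetic
  diffeomorphism (`Φ^* g = e^{2s} g`, `PseudoRiemannianMetric.IsHomothety`; `carrier_map :
  _ = Φ '' 𝒩.carrier`);
* **generators**: `IsGeneratorOn 𝒩 γ s` (affinely parametrised null geodesic on `𝒩` whose velocity
  spans the null normal direction; `isNull_velocity`), `IsMaximalGeneratorOn` (inextendible, so that
  "domain bounded above" = the generator ends at finite affine parameter), `IsRuledByGenerators`;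
* **generator fields** `GeneratorField 𝒩` — a `C¹` vector field `n` with `n^⊥ = ker dv = T𝒩` on
  `𝒩`, null to first order across `𝒩` (`g(∇_w n, n) = 0` for all `w`: the Weingarten map is
  valued in `T𝒩`) and pregeodesic with **inaffinity** `κ` (`∇_n n = κ n`, carried as data) — and
  their pointwise kinematics at `x ∈ 𝒩`, all *canonical* (no screen, rigging or foliation is
  chosen): the spacetime **null Weingarten map** `weingartenMap x = ∇n : T_x M → T_x M`
  (`w ↦ ∇_w n`, eigenvector `n` with eigenvalue `κ`), the **null second fundamental form**
  `secondForm x`, `B(u, v) = g(∇_u n, v)` (`PseudoRiemannianMetric.nullSecondForm`), the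
  **expansion** `expansion x = θ = div n - κ`, the **squared shear**
  `shearNormSq x = |σ|² = |B|²_g - θ²/(d-2)` (`d = dim M`), the Ricci term `ricciField x =
  Ric(n, n)`; flow lines `IsFlowLineOn` (integral curves of `n` on `𝒩`; `velocity_eq`,
  `IsFlowLineOn.isGeneratorOn`: affinely scaled flow lines are generators), the **Raychaudhuri
  identity** as the predicates `SatisfiesRaychaudhuriOn γ s` / `SatisfiesRaychaudhuri`
  (`d/dt θ = κ θ - θ²/(d-2) - |σ|² - Ric(n, n)` along flow lines; right-hand side `raychaudhuri`),
  the **Jacobi area density** `areaDensity γ t₀ t = exp ∫_{t₀}^t θ` along a flow line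
  (`hasDerivAt_areaDensity`, `hasDerivAt_log_areaDensity`: `θ = d/dt log A`) with the elementary
  focusing consequence `concaveOn_sqrt_areaDensity` (`d = 4`, `κ = 0`, `|σ|² + Ric(n,n) ≥ 0` ⟹ `√A`
  concave), time orientation `IsFutureDirected τ`, and **rescaling** `smul f` (`n ↦ f n`) with the
  scaling laws `smul_inaffinity` (`κ' = f κ + n(f)`) and `smul_expansion` (`θ' = f θ`), `constSMul`.

Everything stated as a `lemma`/`theorem` is proved; no named fact is introduced. The Raychaudhuri
identity and "ruled by generators" are predicates (see *What is not formalised*).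

## Sources and dictionary

* G. J. Galloway, *Maximum principles for null hypersurfaces and null splitting theorems*, Ann.
  Henri Poincaré 1 (2000) 543–567, §2.1: smooth null hypersurface `S`, future null tangent field
  `K` with `K^⊥ = TS`, generators, the quotient `TS/K` with its positive definite metric `h`, the
  **null Weingarten map** `b(X̄) = [∇_X K]`, null second fundamental form `B(X̄, Ȳ) = ⟨∇_X K, Y⟩`,
  null mean curvature `θ = tr b = Σᵢ ⟨∇_{eᵢ} K, eᵢ⟩`, `K̃ = fK ⟹ θ̃ = fθ`, the Riccati equation
  `b' + b² + R = 0` and Raychaudhuri `θ' = -Ric(η', η') - σ² - θ²/(n-2)` along affinely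
  parametrised generators.
* E. Gourgoulhon, J. L. Jaramillo, *A 3+1 perspective on null hypersurfaces and isolated horizons*,
  Phys. Rep. 423 (2006) 159–294: §2.5 (`∇_ℓ ℓ = κ ℓ`, the non-affinity coefficient `κ`, null
  generators, scaling `κ' = α(κ + ∇_ℓ ln α)`), §2.6 (Weingarten map `χ : v ↦ ∇_v ℓ` on `T_p 𝓗`,
  valued in `T_p 𝓗` since `ℓ·∇_v ℓ = ½∇_v(ℓ·ℓ) = 0`, `χ(ℓ) = κ ℓ`), §2.7 (second fundamental form
  `Θ(u, v) = u·∇_v ℓ`, symmetric by Frobenius, `Θ' = αΘ`), §5.6 (`θ = tr Θ⃗`, `σ = Θ - ½θq`,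
  **`∇·ℓ = κ + θ`**, `θ = ∇_ℓ ln √q`), §6.2 (`Θ_{μν}Θ^{μν} = σ_{ab}σ^{ab} + ½θ²`, the **null
  Raychaudhuri equation** `∇_ℓ θ - κθ + ½θ² + σ_{ab}σ^{ab} + R(ℓ, ℓ) = 0`).
* S. W. Hawking, G. F. R. Ellis, *The large scale structure of space-time* (1973), §4.2 ((4.35):
  Raychaudhuri for null geodesic congruences, `κ = 0`), §4.3 (focusing), §8.1.
* R. M. Wald, *General Relativity* (1984), §9.2 (`θ = ∇_a k^a` for an affinely parametrised null
  geodesic congruence; `B̂_{ab}`, `σ_{ab}σ^{ab}`).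
* D. Christodoulou, *The formation of black holes in general relativity* (2009), Ch. 1 (`χ`, `tr χ`,
  `χ̂` on the cones `C_u` of an optical function `u`).
* B. O'Neill, *Semi-Riemannian geometry* (1983), Ch. 3, Prop. 3.18 (induced covariant derivative),
  Remark 3.65 (homotheties), Ch. 5, p. 145.

## Design choices

* **Canonical, screen-free scalars.** Galloway's `b`, `θ`, `σ` live on the quotient `T𝒩/ℝn`;
  Gourgoulhon–Jaramillo compute them with a rigging. Here the two properties of a null generator
  field that make the quotient construction work are taken as the axioms of `GeneratorField` —
  (N) `g(∇_w n, n) = 0` for all `w ∈ T_x M` (the spacetime Weingarten map `∇n` maps `T_x M` into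
  `n^⊥ = T_x 𝒩`; for `w ∈ T_x 𝒩` this is automatic, for transversal `w` it normalises the
  irrelevant extension of `n` off `𝒩` to be null to first order, as it is when `n` is null on a
  neighbourhood of `𝒩`, Gourgoulhon–Jaramillo's standing convention via their auxiliary null
  foliation `(𝓗_u)`) and (P) `∇_n n = κ n` — and then `θ` and `|σ|²` are read off the full
  spacetime tensor `∇n` without any choice: since `∇n : T_x M → n^⊥` and `n ↦ κ n`, the trace of
  `∇n` over `T_x M` is `tr(b on n^⊥/ℝn) + κ + 0`, i.e. **`θ := div n - κ`** (G–J §5.6), and in a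
  null frame `(e_A, n, ℓ)`, `g(n, ℓ) = -1`, the only cross terms of `∇_μ n_ν ∇^μ n^ν` pair an
  `n`-slot with an `ℓ`-slot and vanish by (N) (`B(·, n) = 0`) and (P) (`B(n, e_A) = κ g(n, e_A) =
  0`), leaving `Σ_{A,B} B(e_A, e_B)² = |B|²_h`; hence **`|σ|² := |B|²_g - θ²/(d-2)`** (G–J §6.2).
  The value of `κ` is data (`inaffinity`), fixed by (P) on `𝒩` (`n ≠ 0`); (P) holds for every null
  tangent normal field of a null hypersurface (G–J §2.5, Galloway §2.1) but its Frobenius-type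
  derivation is not formalised, so it is a field. Both axioms are preserved by rescaling (`smul`).
* **Generators without a time orientation.** `IsGeneratorOn` allows either orientation (the
  vertex of a past cone is the *future* end of its generators); `GeneratorField.IsFutureDirected τ`
  and `IsFutureDirected.smul` record the orientation when wanted.
* **Area density by quadrature.** The Jacobi area density of the generator congruence is only
  defined up to a constant factor per generator; `areaDensity γ t₀ t := exp ∫_{t₀}^t θ(γ)` is the
  normalisation `A(t₀) = 1` of the solution of `d/dt log A = θ` (the first variation of area,
  G–J §5.6), which is all the routes use (`θ = n log A`, concavity of `√A`); `θ dt` being invariant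
  under `n ↦ f n`, `A` is intrinsic to the generator.
* **Regularity.** `NullLevelSet.fn` is `C^∞` near its zero set (as `SelfSimilarVacuumProfile.coneFn`);
  a generator field is `C¹` at the points of `𝒩` (enough for `∇n`); the metric is `C^n`, `1 ≤ n`
  (`[Fact (1 ≤ n)]`, the Levi-Civita idiom). The Raychaudhuri identity needs `C²` data and is
  therefore a predicate to be assumed where used (true for `C²` metric and field: G–J §6.2,
  Galloway §2.1, Hawking–Ellis (4.35)).
* **General dimension.** `d = dim M = finrank ℝ E`; screens have dimension `d - 2` and the
  trace-free part is taken with `1/(d-2)` (`= ½` for spacetimes; junk value for `d ≤ 2`).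
  `concaveOn_sqrt_areaDensity` is stated for `d = 4` (`A^{1/(d-2)}` in general).

## Bridge to the leafwise null geometry of `HawkingMassFlux.lean`

For a foliated null hypersurface `𝒩 : LorentzianMetric.NullHypersurface g τ` (leaves `S_s = sec s`,
generator `L = ∂_s sec`, adapted pair `(L, L̲)`, `g(L, L̲) = -2`) whose sweep is a level set
`{v = 0}` as above and whose generator `L` extends to a generator field `n` in the present sense
(`n ∘ sec s = L`), the leaf tangent spaces `d(sec s)(T_y S_s) = {L, L̲}^⊥` are screens, Galloway's
`B` restricted to them is the leaf form `χ_L(v, w) = g(D_v L, d(sec s) w)`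
(`nullSecondFundamentalForm`, by `covariantDerivAlong_comp`: `D_v (n ∘ sec s) = ∇_{d(sec s) v} n`),
and therefore `expansion (sec s y) = NullHypersurface.expansion s y` (`θ = tr_γ χ_L = tr b`) and
`shearNormSq (sec s y) = NullHypersurface.shearNormSq s y` (`|χ̂_L|²_γ = |χ_L|²_γ - ½θ_L²`), while
`inaffinity = κ` is the `κ` of the Raychaudhuri/transport equations quoted there. This dictionary is
documentation; the equalities are not proved in this file.

## What is not formalised (and how it is represented)

* that every `NullLevelSet` admits generator fields, is ruled by generators (`IsRuledByGenerators`,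
  a predicate), and that (P) follows from the other axioms;
* the Raychaudhuri identity (`SatisfiesRaychaudhuri`, a predicate with the explicit right-hand side
  `raychaudhuri`), the symmetry of `B` on `T𝒩` and `|σ|² ≥ 0` (taken as the hypothesis
  `0 ≤ |σ|² + Ric(n,n)` in `concaveOn_sqrt_areaDensity`);
* transport under homotheties beyond `NullLevelSet.map`: a homothety `Φ` is an isometry of
  `e^{2s} g`, which has the same Levi-Civita connection as `g`, so `Φ` carries generators to
  generators with the same affine parameter and `n` to `Φ_* n` with `κ`, `θ`, `|σ|²`, `Ric(n, n)`,
  `A` transported unchanged (the factors `e^{-s}` of the route text arise from comparing `Φ_* n`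
  with a differently normalised field on `Φ(𝒩)`, cf. `smul_expansion`); this needs the naturality of
  the Levi-Civita connection (`ConnectionNaturality.lean`) and is left to a later file;
* the bridge equalities above.
-/

noncomputable section

open Bundle Set Function Filter
open scoped Manifold ContDiff Topology

namespace Literature.Geometry.Lorentzian

-- every `C^n` metric, `1 ≤ n`, has its Levi-Civita connection (`LeviCivitaProofs.lean`); as a
-- local instance so that `leviCivita`, `ricci`, `divVector` elaborate for the metrics below
attribute [local instance] PseudoRiemannianMetric.hasLeviCivita

variable {E : Type*} [NormedAddCommGroup E] [NormedSpace ℝ E] {H : Type*} [TopologicalSpace H]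
  {I : ModelWithCorners ℝ E H} {M : Type*} [TopologicalSpace M] [ChartedSpace H M]
  [IsManifold I ∞ M] {n : ℕ∞ω}

/-! ### The covariant differential of a vector field as a bilinear form -/

namespace PseudoRiemannianMetric

variable [FiniteDimensional ℝ E] [CompleteSpace E] [Fact (1 ≤ n)]
  (g : PseudoRiemannianMetric I n E (TangentSpace I : M → Type _))

/-- For a vector field `X` on `M` and a point `x`, the bilinear form
`B_X(u, v) = g_x(∇_u X, v)` on `T_x M` — the covariant differential `∇X^♭` read as a bilinear
form (`(∇_u X^♭)(v)`; Mathlib's argument order `g.leviCivita X x u = ∇_u X`). For a null generator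
field `n` of a null hypersurface `𝒩` its restriction to `T_x 𝒩 × T_x 𝒩` is the **null second
fundamental form** `B(X, Y) = ⟨∇_X K, Y⟩` of Galloway (Ann. Henri Poincaré 1 (2000), §2.1) and the
second fundamental form `Θ(u, v) = u · ∇_v ℓ` of Gourgoulhon–Jaramillo (Phys. Rep. 423 (2006),
§2.7, symmetric on `T𝒩`); see `LorentzianMetric.NullLevelSet.GeneratorField.secondForm`. Junk
value `0` in the first slot at points where `X` is not differentiable (inherited from
`leviCivita`). [cite: Galloway2000, §2.1] -/
def nullSecondForm (X : Π x : M, TangentSpace I x) (x : M) :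
    LinearMap.BilinForm ℝ (TangentSpace I x) :=
  (g.toBilinForm x).compLeft (g.leviCivita X x).toLinearMap

/-- Unfolding lemma: `B_X(u, v) = g(∇_u X, v)`. [folklore] -/
@[simp]
lemma nullSecondForm_apply (X : Π x : M, TangentSpace I x) (x : M) (u v : TangentSpace I x) :
    g.nullSecondForm X x u v = g.val x (g.leviCivita X x u) v :=
  rfl

end PseudoRiemannianMetric

/-! ### Null hypersurfaces presented as regular level sets -/

namespace LorentzianMetric

variable [FiniteDimensional ℝ E] [CompleteSpace E]

/-- Hypothesis structure: a **null hypersurface presented as a regular level set** of the `C^n`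
Lorentzian manifold `(M, g)` — a function `v = fn : M → ℝ`, `C^∞` at the points of its zero set
`𝒩 = {v = 0}` (`carrier`), such that at each `x ∈ 𝒩` the kernel of `dv_x` is the `g`-orthogonal
complement `L^⊥` of a **null** vector `L ∈ T_x M` (so `dv_x ≠ 0`, `𝒩` is a smooth embedded
hypersurface near `x`, `T_x 𝒩 = ker dv_x = L^⊥` is a null hyperplane and `ℝL ⊆ T_x 𝒩` is its
null direction, the direction of the **generator** through `x`). This is exactly the shape of the
vertex past cone `{v = 0}` of `SelfSimilarVacuumProfile` (`SelfSimilarVacuumProfile.coneLevelSet`)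
and of the level sets `u = const` of an optical function. Galloway 2000, §2.1 (a smooth null
hypersurface: the pullback of `g` degenerates, with one-dimensional null space `ℝK`,
`K_p^⊥ = T_p S`); Gourgoulhon–Jaramillo 2006, §2.1–2.3 (`𝓗` as a level set `u = 1`, null normal
`ℓ ∝ ∇u`). Only the zero set and the null-kernel property of `v` enter; `v` need not be an
optical (eikonal) function off `𝒩`. [cite: Galloway2000, §2.1] -/
structure NullLevelSet (g : LorentzianMetric I n M) where
  /-- The level-set function `v`; the hypersurface is `{v = 0}`. -/
  fn : M → ℝ
  /-- `v` is `C^∞` at the points of its zero set. -/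
  contMDiffAt_fn : ∀ x, fn x = 0 → ContMDiffAt I 𝓘(ℝ, ℝ) ∞ fn x
  /-- At each point of the zero set, `ker dv` is the orthogonal complement of a null vector. -/
  exists_isNull : ∀ x, fn x = 0 → ∃ L : TangentSpace I x, g.IsNull L ∧
    ∀ w : TangentSpace I x, mfderiv I 𝓘(ℝ, ℝ) fn x w = 0 ↔ g.val x L w = 0

namespace NullLevelSet

variable {g : LorentzianMetric I n M} (𝒩 : g.NullLevelSet)

/-- The null hypersurface itself: the zero set `{v = 0}`. [folklore] -/
def carrier : Set M := {x | 𝒩.fn x = 0}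

omit [FiniteDimensional ℝ E] [CompleteSpace E] in
/-- Membership in the carrier. [folklore] -/
@[simp] lemma mem_carrier_iff {x : M} : x ∈ 𝒩.carrier ↔ 𝒩.fn x = 0 := Iff.rfl

omit [FiniteDimensional ℝ E] [CompleteSpace E] in
/-- `dv ≠ 0` on `𝒩` (the null vector `L` is nonzero and `g` is nondegenerate): `𝒩` is a regular
level set. [folklore] -/
lemma mfderiv_fn_ne_zero {x : M} (hx : x ∈ 𝒩.carrier) : mfderiv I 𝓘(ℝ, ℝ) 𝒩.fn x ≠ 0 := by
  obtain ⟨L, hL, hker⟩ := 𝒩.exists_isNull x hx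
  intro h0
  apply hL.2
  apply g.nondegenerate x L
  intro w
  exact (hker w).mp (by rw [h0]; rfl)

omit [FiniteDimensional ℝ E] [CompleteSpace E] in
/-- **Linear algebra of the null normal.** If at `x ∈ 𝒩` a vector `v` has the same orthogonal
complement as the generator direction, `v^⊥ = ker dv_x (= L^⊥)`, then `v` is null: `L ∈ L^⊥ = v^⊥`
gives `g(v, L) = 0`, i.e. `v ∈ L^⊥ = v^⊥`; and `v ≠ 0` since `dv_x ≠ 0`. (So the generator
direction at `x` is the unique null line in `T_x 𝒩`.) Galloway 2000, §2.1 ("tangent vectors to `S`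
not parallel to `K` are spacelike"). [cite: Galloway2000, §2.1] -/
lemma isNull_of_ker_iff {x : M} (hx : x ∈ 𝒩.carrier) {v : TangentSpace I x}
    (hv : ∀ w : TangentSpace I x, mfderiv I 𝓘(ℝ, ℝ) 𝒩.fn x w = 0 ↔ g.val x v w = 0) :
    g.IsNull v := by
  obtain ⟨L, hL, hker⟩ := 𝒩.exists_isNull x hx
  refine ⟨?_, fun h0 ↦ 𝒩.mfderiv_fn_ne_zero hx ?_⟩
  · -- `g(L, L) = 0` ⇒ `dv(L) = 0` ⇒ `g(v, L) = 0` ⇒ `dv(v) = 0` ⇒ `g(v, v) = 0`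
    have h1 : mfderiv I 𝓘(ℝ, ℝ) 𝒩.fn x L = 0 := (hker L).mpr hL.1
    have h2 : g.val x v L = 0 := (hv L).mp h1
    have h3 : mfderiv I 𝓘(ℝ, ℝ) 𝒩.fn x v = 0 := (hker v).mpr (by rw [g.symm]; exact h2)
    exact (hv v).mp h3
  · ext w
    have : g.val x v w = 0 := by rw [h0]; simp
    exact (hv w).mpr this

/-! #### Generators -/

variable [Fact (1 ≤ n)]

/-- The curve `γ` is a **(null geodesic) generator of `𝒩` on the parameter set `s`**: it is an
(affinely parametrised) geodesic of the Levi-Civita connection on `s` (`IsGeodesicOn`), lies on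
`𝒩`, and its velocity spans the generator direction: `γ'(t)^⊥ = ker dv_{γ t} = T_{γ t} 𝒩` (so
`γ'(t)` is the null normal, `IsGeneratorOn.isNull_velocity`). Either time orientation is allowed.
Galloway 2000, §2.1 ("the integral curves of `K`, when suitably parameterized, are null geodesics …
called the null geodesic generators of `S`"); Gourgoulhon–Jaramillo 2006, §2.5; Hawking–Ellis
1973, §4.2. [cite: Galloway2000, §2.1] -/
def IsGeneratorOn (γ : ℝ → M) (s : Set ℝ) : Prop :=
  IsGeodesicOn g.leviCivita γ s ∧ ∀ t ∈ s, γ t ∈ 𝒩.carrier ∧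
    ∀ w : TangentSpace I (γ t), mfderiv I 𝓘(ℝ, ℝ) 𝒩.fn (γ t) w = 0 ↔
      g.val (γ t) (velocity I γ t) w = 0

variable {𝒩}

/-- A generator is a geodesic. [folklore] -/
lemma IsGeneratorOn.isGeodesicOn {γ : ℝ → M} {s : Set ℝ} (h : 𝒩.IsGeneratorOn γ s) :
    IsGeodesicOn g.leviCivita γ s :=
  h.1

/-- A generator lies on the hypersurface. [folklore] -/
lemma IsGeneratorOn.mem_carrier {γ : ℝ → M} {s : Set ℝ} (h : 𝒩.IsGeneratorOn γ s) {t : ℝ}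
    (ht : t ∈ s) : γ t ∈ 𝒩.carrier :=
  (h.2 t ht).1

/-- The velocity of a generator is null (and nonzero). Galloway 2000, §2.1. [cite: Galloway2000, §2.1] -/
lemma IsGeneratorOn.isNull_velocity {γ : ℝ → M} {s : Set ℝ} (h : 𝒩.IsGeneratorOn γ s) {t : ℝ}
    (ht : t ∈ s) : g.IsNull (velocity I γ t) :=
  𝒩.isNull_of_ker_iff (h.2 t ht).1 (h.2 t ht).2

/-- Restriction of the parameter set of a generator. [folklore] -/
lemma IsGeneratorOn.mono {γ : ℝ → M} {s s' : Set ℝ} (h : 𝒩.IsGeneratorOn γ s) (hs : s' ⊆ s) :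
    𝒩.IsGeneratorOn γ s' :=
  ⟨h.1.mono hs, fun t ht ↦ h.2 t (hs ht)⟩

variable (𝒩)

/-- `γ` is a **maximal generator with domain `s`**: a maximal (inextendible, affinely
parametrised) geodesic of `(M, g)` with domain the open interval `s` (`IsMaximalGeodesicOn`) which
is a generator of `𝒩` on all of `s`. Its parameter is an affine parameter, so "`s` bounded above"
expresses that the generator is future incomplete (e.g. reaches an absent vertex at finite affine
parameter). Hawking–Ellis 1973, §4.2 and §8.1. [cite: HawkingEllis1973, §4.2 and §8.1] -/
def IsMaximalGeneratorOn (γ : ℝ → M) (s : Set ℝ) : Prop :=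
  IsMaximalGeodesicOn g.leviCivita γ s ∧ 𝒩.IsGeneratorOn γ s

variable {𝒩} in
/-- A maximal generator is a generator. [folklore] -/
lemma IsMaximalGeneratorOn.isGeneratorOn {γ : ℝ → M} {s : Set ℝ}
    (h : 𝒩.IsMaximalGeneratorOn γ s) : 𝒩.IsGeneratorOn γ s :=
  h.2

/-- `𝒩` is **ruled by its generators**: through every point of `𝒩` passes a generator defined on
an open parameter set around `0`. True for every null hypersurface of a spacetime with `C¹`
Levi-Civita connection (the integral curves of a null generator field are pregeodesics,
Gourgoulhon–Jaramillo 2006, §2.5: "a fundamental property of null hypersurfaces: they are ruled by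
null geodesics"; Galloway 2000, §2.1); recorded as a predicate, the ODE argument not being
formalised here. [cite: GourgoulhonJaramillo2006, §2.5] -/
def IsRuledByGenerators (𝒩 : g.NullLevelSet) : Prop :=
  ∀ x ∈ 𝒩.carrier, ∃ (γ : ℝ → M) (s : Set ℝ), IsOpen s ∧ 0 ∈ s ∧ γ 0 = x ∧ 𝒩.IsGeneratorOn γ s

/-! #### Generator fields and their kinematics -/

/-- Hypothesis structure: a **(pregeodesic) null generator field** of the level-set null
hypersurface `𝒩 = {v = 0}` together with its inaffinity. Data: a vector field `n = field` on `M`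
and a function `κ = inaffinity : M → ℝ` (both only relevant at the points of `𝒩`), such that at
every `x ∈ 𝒩`:

* `n` is `C¹` at `x` (as a section of `TM`; so `∇n` is meaningful);
* `n_x^⊥ = ker dv_x = T_x 𝒩` (`ker_iff`): `n_x` spans the null normal = generator direction (hence
  `n_x` is null and nonzero, `isNull_field`, and tangent to `𝒩`);
* `g(∇_w n, n) = 0` for **all** `w ∈ T_x M` (`val_leviCivita_field`): the (spacetime) Weingarten
  map `w ↦ ∇_w n` takes values in `n^⊥ = T_x 𝒩` (Gourgoulhon–Jaramillo 2006, §2.6: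
  `ℓ · ∇_v ℓ = ½ ∇_v(ℓ · ℓ) = 0`). For `w` tangent to `𝒩` this is automatic; for transversal `w`
  it says `d(g(n, n))_x = 0`, i.e. the extension of `n` off `𝒩` is null to first order — a
  normalisation of the (irrelevant) extension which always exists and holds e.g. when `n` is null
  on a neighbourhood of `𝒩` (Gourgoulhon–Jaramillo extend `ℓ` by an auxiliary null foliation,
  §2.3);
* `∇_n n = κ n` (`leviCivita_field_field`): `n` is pregeodesic with **inaffinity** (non-affinity
  coefficient, "surface gravity" in the Killing case) `κ` — true for every null tangent normal
  field of a null hypersurface (Gourgoulhon–Jaramillo 2006, §2.5, `∇_ℓ ℓ = κ ℓ`; Galloway 2000,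
  §2.1), recorded as a field because the Frobenius argument is not formalised; `κ` is determined
  by `n` on `𝒩` (`n ≠ 0`).

With these two properties the kinematical scalars below are the canonical ones of the quotient
bundle `T𝒩/ℝn` (Galloway's `b`, `θ = tr b`, `σ`), computed without choosing a screen or a
rigging: see `expansion` and `shearNormSq`. Rescaling `n ↦ f n` (`f > 0`): `smul`.
[cite: GourgoulhonJaramillo2006, §2.5–2.6] -/
structure GeneratorField (𝒩 : g.NullLevelSet) where
  /-- The generator vector field `n` (on `M`; relevant near `𝒩`). -/
  field : Π x : M, TangentSpace I x
  /-- The inaffinity `κ`: `∇_n n = κ n` on `𝒩`. -/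
  inaffinity : M → ℝ
  /-- `n` is `C¹` at the points of `𝒩`. -/
  contMDiffAt_field : ∀ x ∈ 𝒩.carrier,
    ContMDiffAt I I.tangent 1 (fun y ↦ (TotalSpace.mk' E y (field y) : TangentBundle I M)) x
  /-- `n^⊥ = ker dv = T𝒩` on `𝒩`: `n` is the null normal (generator direction). -/
  ker_iff : ∀ x ∈ 𝒩.carrier, ∀ w : TangentSpace I x,
    mfderiv I 𝓘(ℝ, ℝ) 𝒩.fn x w = 0 ↔ g.val x (field x) w = 0
  /-- The Weingarten map `w ↦ ∇_w n` takes values in `n^⊥` (first-order nullity of `n`). -/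
  val_leviCivita_field : ∀ x ∈ 𝒩.carrier, ∀ w : TangentSpace I x,
    g.val x (g.leviCivita field x w) (field x) = 0
  /-- `n` is pregeodesic with inaffinity `κ`: `∇_n n = κ n` on `𝒩`. -/
  leviCivita_field_field : ∀ x ∈ 𝒩.carrier,
    g.leviCivita field x (field x) = inaffinity x • field x

namespace GeneratorField

variable {𝒩} (F : 𝒩.GeneratorField)

/-- The generator field is null (and nonzero) on `𝒩` (`isNull_of_ker_iff`). Galloway 2000, §2.1.
[cite: Galloway2000, §2.1] -/
lemma isNull_field {x : M} (hx : x ∈ 𝒩.carrier) : g.IsNull (F.field x) :=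
  𝒩.isNull_of_ker_iff hx (F.ker_iff x hx)

/-- The generator field does not vanish on `𝒩`. [folklore] -/
lemma field_ne_zero {x : M} (hx : x ∈ 𝒩.carrier) : F.field x ≠ 0 :=
  (F.isNull_field hx).2

/-- `g(n, n) = 0` on `𝒩`. [folklore] -/
lemma val_field_field {x : M} (hx : x ∈ 𝒩.carrier) : g.val x (F.field x) (F.field x) = 0 :=
  (F.isNull_field hx).1

/-- The generator field is tangent to `𝒩`: `dv(n) = 0` on `𝒩`. [folklore] -/
lemma mfderiv_fn_field {x : M} (hx : x ∈ 𝒩.carrier) :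
    mfderiv I 𝓘(ℝ, ℝ) 𝒩.fn x (F.field x) = 0 :=
  (F.ker_iff x hx _).mpr (F.val_field_field hx)

/-- The generator field is differentiable (as a section of `TM`) at the points of `𝒩`. [folklore] -/
lemma mdifferentiableAt_field {x : M} (hx : x ∈ 𝒩.carrier) :
    MDifferentiableAt I I.tangent (fun y ↦ (TotalSpace.mk' E y (F.field y) : TangentBundle I M)) x :=
  (F.contMDiffAt_field x hx).mdifferentiableAt one_ne_zero

/-- The **(spacetime) null Weingarten map** `χ_x : T_x M → T_x M`, `w ↦ ∇_w n`, of the generator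
field at `x` (the covariant differential of `n`, `g.leviCivita n x`). On `T_x 𝒩 = n^⊥` it is the
Weingarten map `χ : v ↦ ∇_v ℓ` of Gourgoulhon–Jaramillo 2006, §2.6 (valued in `T_x 𝒩`,
`val_leviCivita_field`; `n` is an eigenvector with eigenvalue `κ`, `weingartenMap_field`), which
descends to Galloway's null Weingarten map `b([X]) = [∇_X K]` of `T_x 𝒩 / ℝ n` (Galloway 2000,
§2.1); by `val_leviCivita_field` it maps all of `T_x M` into `n^⊥`. [cite: GourgoulhonJaramillo2006, §2.6] -/
def weingartenMap (x : M) : TangentSpace I x →L[ℝ] TangentSpace I x :=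
  g.leviCivita F.field x

/-- `χ(n) = κ n`: the generator is an eigenvector of the Weingarten map with eigenvalue the
inaffinity. Gourgoulhon–Jaramillo 2006, §2.6, eq. `χ(ℓ) = κ ℓ`. [cite: GourgoulhonJaramillo2006, §2.6] -/
lemma weingartenMap_field {x : M} (hx : x ∈ 𝒩.carrier) :
    F.weingartenMap x (F.field x) = F.inaffinity x • F.field x :=
  F.leviCivita_field_field x hx

/-- The **null second fundamental form** `B_x(u, v) = g(∇_u n, v)` of the generator field at `x`
(`PseudoRiemannianMetric.nullSecondForm`), a bilinear form on `T_x M` whose restriction to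
`T_x 𝒩 × T_x 𝒩` is Galloway's `B(X̄, Ȳ) = ⟨∇_X K, Y⟩` (symmetric there; it vanishes when either
slot is `n`, `secondForm_right_field`, `secondForm_field_left`) and descends to `T_x 𝒩 / ℝ n`.
Galloway 2000, §2.1; Gourgoulhon–Jaramillo 2006, §2.7 (`Θ`). [cite: Galloway2000, §2.1] -/
def secondForm (x : M) : LinearMap.BilinForm ℝ (TangentSpace I x) :=
  g.nullSecondForm F.field x

/-- `B(u, v) = g(∇_u n, v)`. [folklore] -/
@[simp]
lemma secondForm_apply (x : M) (u v : TangentSpace I x) :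
    F.secondForm x u v = g.val x (g.leviCivita F.field x u) v :=
  rfl

/-- `B(u, n) = 0`: the Weingarten map is valued in `n^⊥`. Gourgoulhon–Jaramillo 2006, §2.6.
[cite: GourgoulhonJaramillo2006, §2.6] -/
lemma secondForm_right_field {x : M} (hx : x ∈ 𝒩.carrier) (u : TangentSpace I x) :
    F.secondForm x u (F.field x) = 0 :=
  F.val_leviCivita_field x hx u

/-- `B(n, v) = κ g(n, v)` (so `B(n, ·) = 0` on `T_x 𝒩 = n^⊥`). Gourgoulhon–Jaramillo 2006, §2.6.
[cite: GourgoulhonJaramillo2006, §2.6] -/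
lemma secondForm_field_left {x : M} (hx : x ∈ 𝒩.carrier) (v : TangentSpace I x) :
    F.secondForm x (F.field x) v = F.inaffinity x * g.val x (F.field x) v := by
  rw [secondForm_apply, F.leviCivita_field_field x hx, map_smul]
  rfl

/-- The **expansion** (null mean curvature) `θ_n(x) = div n - κ` of the generator field at `x`:
the trace of Galloway's null Weingarten map `b` on `T_x 𝒩 / ℝ n`, `θ = tr b = Σᵢ ⟨∇_{eᵢ} n, eᵢ⟩`
over an orthonormal pair `e₁, e₂` of spacelike vectors tangent to `𝒩` (Galloway 2000, §2.1),
computed screen-free through the identity `∇ · n = κ + θ` (Gourgoulhon–Jaramillo 2006, §5.6,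
eq. `∇·ℓ = κ + θ`; Wald 1984, §9.2 for `κ = 0`): the spacetime Weingarten map `∇n` maps `T_x M`
into `n^⊥` (`val_leviCivita_field`) and `n ↦ κ n`, so its full trace `div n`
(`PseudoRiemannianMetric.divVector`) is `tr b + κ + 0`. Under `n ↦ f n`, `θ ↦ f θ`
(`smul_expansion`). [cite: GourgoulhonJaramillo2006, §5.6] -/
def expansion (x : M) : ℝ :=
  g.divVector F.field x - F.inaffinity x

/-- `div n = θ + κ`. Gourgoulhon–Jaramillo 2006, §5.6. [cite: GourgoulhonJaramillo2006, §5.6] -/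
lemma divVector_field (x : M) : g.divVector F.field x = F.expansion x + F.inaffinity x := by
  rw [expansion, sub_add_cancel]

/-- The **squared shear** `|σ_n|²(x) = σ_{ab} σ^{ab}` of the generator field at `x`: with
`d = dim M`, the screens `T_x 𝒩 / ℝ n` have dimension `d - 2`, the shear is the trace-free part
`σ = B - (θ/(d-2)) h` of the null second fundamental form on the screen (Galloway 2000, §2.1:
"`σ²`, the trace of the square of the trace free part of `b`"; Gourgoulhon–Jaramillo 2006, §5.6,
`σ := Θ - ½ θ q` for `d = 4`) and `|σ|² = |B|²_h - θ²/(d-2)` (Gourgoulhon–Jaramillo 2006, §6.2: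
`Θ_{μν} Θ^{μν} = σ_{ab} σ^{ab} + ½ θ²`). It is computed screen-free as
`|B|²_g - θ²/(d-2)` with `|B|²_g = ∇_μ n_ν ∇^μ n^ν` the metric square norm of `secondForm` over
`T_x M` (`PseudoRiemannianMetric.normSq`): in a null frame `(e_A, n, ℓ)`, `g(n, ℓ) = -1`, the only
cross terms of `∇_μ n_ν ∇^μ n^ν` pair an `n`-slot with an `ℓ`-slot, and they vanish because
`B(·, n) = 0` (`val_leviCivita_field`) and `B(n, e_A) = κ g(n, e_A) = 0` (`leviCivita_field_field`),
leaving `Σ_{A,B} B(e_A, e_B)² = |B|²_h`. Nonnegative (the screen metric is positive definite and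
`B` is symmetric there), but this is not proved here. Junk value when `d ≤ 2`.
[cite: GourgoulhonJaramillo2006, §6.2] -/
def shearNormSq (x : M) : ℝ :=
  g.normSq x (F.secondForm x) - F.expansion x ^ 2 / ((Module.finrank ℝ E : ℝ) - 2)

/-- The **Ricci term** `Ric(n, n)(x)` along the generator field (`= 8π T(n, n)` under the
Einstein equations). Hawking–Ellis 1973, §4.2. [cite: HawkingEllis1973, §4.2] -/
def ricciField (x : M) : ℝ :=
  g.ricci x (F.field x) (F.field x)

/-! #### Flow lines, the Raychaudhuri identity, the Jacobi area density -/

/-- `γ` is a **flow line of the generator field on `s`** lying on `𝒩`: an integral curve of `n`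
on `s` (`IsMIntegralCurveOn`, `γ' = n ∘ γ`) all of whose points `γ t`, `t ∈ s`, lie on `𝒩` — a
generator of `𝒩` in the (in general non-affine) parametrisation defined by `n`
(`dt(n) = 1`). Gourgoulhon–Jaramillo 2006, §2.5 (the parameter `τ` with `ℓ^α = dx^α/dτ`).
[cite: GourgoulhonJaramillo2006, §2.5] -/
def IsFlowLineOn (γ : ℝ → M) (s : Set ℝ) : Prop :=
  IsMIntegralCurveOn γ F.field s ∧ ∀ t ∈ s, γ t ∈ 𝒩.carrier

/-- The right-hand side of the Raychaudhuri equation for the generator field at `x`: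
`κ θ - θ²/(d-2) - |σ|² - Ric(n, n)` (`d = dim M`; `-½ θ²` for spacetimes).
Gourgoulhon–Jaramillo 2006, §6.2. [cite: GourgoulhonJaramillo2006, §6.2] -/
def raychaudhuri (x : M) : ℝ :=
  F.inaffinity x * F.expansion x - F.expansion x ^ 2 / ((Module.finrank ℝ E : ℝ) - 2) -
    F.shearNormSq x - F.ricciField x

/-- The generator field **satisfies the Raychaudhuri identity along the curve `γ` on `s`**:
for every `t ∈ s`,

  `d/dt θ(γ t) = κ θ - θ²/(d-2) - |σ|² - Ric(n, n)`  at `γ t`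

(`HasDerivAt`; meant for flow lines `γ' = n` of the generator field on `𝒩`, along which
`d/dt = ∇_n`). This is the null Raychaudhuri equation for the hypersurface-orthogonal (twist-free)
congruence of generators — Gourgoulhon–Jaramillo 2006, §6.2
(`∇_ℓ θ - κ θ + ½ θ² + σ_{ab} σ^{ab} + R(ℓ, ℓ) = 0`), Galloway 2000, §2.1 (`θ' = -Ric(η', η') -
σ² - θ²/(n-2)` along affinely parametrised generators, from the Riccati equation `b' + b² + R = 0`),
Hawking–Ellis 1973, §4.2, (4.35) (`κ = 0`) — valid whenever `g` and `n` are `C²`; it is recorded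
as a predicate, the second-variation calculus not being formalised. [cite: GourgoulhonJaramillo2006, §6.2] -/
def SatisfiesRaychaudhuriOn (γ : ℝ → M) (s : Set ℝ) : Prop :=
  ∀ t ∈ s, HasDerivAt (fun t ↦ F.expansion (γ t)) (F.raychaudhuri (γ t)) t

/-- The generator field **satisfies the Raychaudhuri identity**: along every flow line on `𝒩`
defined on an open parameter set (`IsFlowLineOn`), `SatisfiesRaychaudhuriOn` holds.
Gourgoulhon–Jaramillo 2006, §6.2; Galloway 2000, §2.1; Hawking–Ellis 1973, (4.35).
[cite: GourgoulhonJaramillo2006, §6.2] -/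
def SatisfiesRaychaudhuri (F : 𝒩.GeneratorField) : Prop :=
  ∀ (γ : ℝ → M) (s : Set ℝ), IsOpen s → F.IsFlowLineOn γ s → F.SatisfiesRaychaudhuriOn γ s

/-- The **Jacobi area density** `A_γ(t₀; t) = exp (∫_{t₀}^{t} θ(γ s) ds)` along the curve `γ`
(meant: a flow line of the generator field), normalised by `A_γ(t₀; t₀) = 1`: the solution of the
first variation of area `d/dt log A = θ` (`hasDerivAt_log_areaDensity`), i.e. the factor by which
the generator congruence has expanded the transversal (screen) area element between `γ t₀` and
`γ t` — `θ = ∇_ℓ ln √q` with `√q` the area element of the cross-sections (Gourgoulhon–Jaramillo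
2006, §5.6), equivalently the determinant of the Jacobi map of the congruence on a screen. It is
intrinsic to the generator up to the multiplicative constant fixed by `t₀` (under `n ↦ f n`,
`θ dt` is invariant). Interval integral with Mathlib's orientation convention (so `A_γ(t₀; t)` is
also defined for `t < t₀`); junk value `exp 0 = 1` on non-integrable stretches.
[cite: GourgoulhonJaramillo2006, §5.6] -/
def areaDensity (γ : ℝ → M) (t₀ t : ℝ) : ℝ :=
  Real.exp (∫ s in t₀..t, F.expansion (γ s))

/-- The area density is positive. [folklore] -/
lemma areaDensity_pos (γ : ℝ → M) (t₀ t : ℝ) : 0 < F.areaDensity γ t₀ t :=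
  Real.exp_pos _

/-- Normalisation `A_γ(t₀; t₀) = 1`. [folklore] -/
@[simp]
lemma areaDensity_self (γ : ℝ → M) (t₀ : ℝ) : F.areaDensity γ t₀ t₀ = 1 := by
  simp [areaDensity]

/-- `log A_γ(t₀; t) = ∫_{t₀}^{t} θ`. [folklore] -/
lemma log_areaDensity (γ : ℝ → M) (t₀ t : ℝ) :
    Real.log (F.areaDensity γ t₀ t) = ∫ s in t₀..t, F.expansion (γ s) :=
  Real.log_exp _

/-- `√A_γ(t₀; t) = exp (½ ∫_{t₀}^{t} θ)`. [folklore] -/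
lemma sqrt_areaDensity (γ : ℝ → M) (t₀ t : ℝ) :
    Real.sqrt (F.areaDensity γ t₀ t) = Real.exp ((∫ s in t₀..t, F.expansion (γ s)) / 2) := by
  rw [areaDensity, Real.exp_half]

/-- **First variation of area**: if the expansion is continuous along `γ` on the open interval
`J`, then for `t₀, t ∈ J`, `d/dt A_γ(t₀; t) = θ(γ t) A_γ(t₀; t)` (fundamental theorem of
calculus). Gourgoulhon–Jaramillo 2006, §5.6 (`θ = ∇_ℓ ln √q`); Hawking–Ellis 1973, §4.2.
[cite: GourgoulhonJaramillo2006, §5.6] -/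
theorem hasDerivAt_areaDensity {γ : ℝ → M} {J : Set ℝ} (hJ : IsOpen J) (hJc : J.OrdConnected)
    (hθ : ContinuousOn (fun s ↦ F.expansion (γ s)) J) {t₀ t : ℝ} (ht₀ : t₀ ∈ J) (ht : t ∈ J) :
    HasDerivAt (F.areaDensity γ t₀) (F.expansion (γ t) * F.areaDensity γ t₀ t) t := by
  have hint : IntervalIntegrable (fun s ↦ F.expansion (γ s)) MeasureTheory.volume t₀ t :=
    (hθ.mono (hJc.uIcc_subset ht₀ ht)).intervalIntegrable
  have hI : HasDerivAt (fun u ↦ ∫ s in t₀..u, F.expansion (γ s)) (F.expansion (γ t)) t :=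
    intervalIntegral.integral_hasDerivAt_right hint (hθ.stronglyMeasurableAtFilter hJ t ht)
      (hθ.continuousAt (hJ.mem_nhds ht))
  have h := hI.exp
  rw [mul_comm] at h
  exact h

/-- **`θ = d/dt log A`** along `γ` (for continuous `θ ∘ γ` on an open interval `J ∋ t₀, t`): the
defining property of the Jacobi area density. Gourgoulhon–Jaramillo 2006, §5.6.
[cite: GourgoulhonJaramillo2006, §5.6] -/
theorem hasDerivAt_log_areaDensity {γ : ℝ → M} {J : Set ℝ} (hJ : IsOpen J) (hJc : J.OrdConnected)
    (hθ : ContinuousOn (fun s ↦ F.expansion (γ s)) J) {t₀ t : ℝ} (ht₀ : t₀ ∈ J) (ht : t ∈ J) :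
    HasDerivAt (fun u ↦ Real.log (F.areaDensity γ t₀ u)) (F.expansion (γ t)) t := by
  have hint : IntervalIntegrable (fun s ↦ F.expansion (γ s)) MeasureTheory.volume t₀ t :=
    (hθ.mono (hJc.uIcc_subset ht₀ ht)).intervalIntegrable
  have hI : HasDerivAt (fun u ↦ ∫ s in t₀..u, F.expansion (γ s)) (F.expansion (γ t)) t :=
    intervalIntegral.integral_hasDerivAt_right hint (hθ.stronglyMeasurableAtFilter hJ t ht)
      (hθ.continuousAt (hJ.mem_nhds ht))
  simp only [log_areaDensity]
  exact hI

/-- **Focusing: `√A` is concave along an affinely parametrised generator under the null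
convergence condition** (spacetime dimension `4`). If along the curve `γ` on the open interval `J`
the Raychaudhuri identity holds (`SatisfiesRaychaudhuriOn`), the generator field is affinely
scaled there (`κ ∘ γ = 0`) and `|σ|² + Ric(n, n) ≥ 0` (e.g. `|σ|² ≥ 0` and the null convergence
condition `SatisfiesNullConvergence`), then `t ↦ √(A_γ(t₀; t))` is concave on `J`: with
`ρ = √A = exp(½ ∫ θ)`, `ρ' = ½ θ ρ` and `ρ'' = ½ ρ (θ' + ½ θ²) = -½ ρ (|σ|² + Ric(n, n)) ≤ 0`.
This is the elementary content of the focusing theorem (Hawking–Ellis 1973, §4.2–4.3, the argument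
following (4.35); Galloway 2000, §2.1, the Raychaudhuri equation) used by route
FinalStateConjecture/HomotheticSurfaceGravity (item ConcaveScalingRigidity).
[cite: HawkingEllis1973, §4.2–4.3] -/
theorem concaveOn_sqrt_areaDensity (hE : Module.finrank ℝ E = 4) {γ : ℝ → M} {J : Set ℝ}
    (hJ : IsOpen J) (hJc : J.OrdConnected) (hR : F.SatisfiesRaychaudhuriOn γ J)
    (hκ : ∀ t ∈ J, F.inaffinity (γ t) = 0)
    (hnec : ∀ t ∈ J, 0 ≤ F.shearNormSq (γ t) + F.ricciField (γ t)) {t₀ : ℝ} (ht₀ : t₀ ∈ J) :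
    ConcaveOn ℝ J (fun t ↦ Real.sqrt (F.areaDensity γ t₀ t)) := by
  set θ : ℝ → ℝ := fun s ↦ F.expansion (γ s) with hθdef
  -- the integral `Φ(u) = ∫_{t₀}^u θ` and `ρ = exp(Φ/2) = √A`
  set Φ : ℝ → ℝ := fun u ↦ ∫ s in t₀..u, θ s with hΦdef
  set ρ : ℝ → ℝ := fun u ↦ Real.exp (Φ u / 2) with hρdef
  have hθc : ContinuousOn θ J := fun t ht ↦ (hR t ht).continuousAt.continuousWithinAt
  have hΦ : ∀ t ∈ J, HasDerivAt Φ (θ t) t := fun t ht ↦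
    intervalIntegral.integral_hasDerivAt_right ((hθc.mono (hJc.uIcc_subset ht₀ ht)).intervalIntegrable)
      (hθc.stronglyMeasurableAtFilter hJ t ht) (hθc.continuousAt (hJ.mem_nhds ht))
  have hρ : ∀ t ∈ J, HasDerivAt ρ (θ t / 2 * ρ t) t := fun t ht ↦ by
    have h := ((hΦ t ht).div_const 2).exp
    rw [mul_comm] at h
    exact h
  have hρ' : ∀ t ∈ J, HasDerivAt (fun u ↦ θ u / 2 * ρ u)
      (F.raychaudhuri (γ t) / 2 * ρ t + θ t / 2 * (θ t / 2 * ρ t)) t := fun t ht ↦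
    ((hR t ht).div_const 2).mul (hρ t ht)
  have hfun : (fun t ↦ Real.sqrt (F.areaDensity γ t₀ t)) = ρ := funext fun t ↦ F.sqrt_areaDensity γ t₀ t
  rw [hfun]
  have hE' : (Module.finrank ℝ E : ℝ) - 2 = 2 := by rw [hE]; norm_num
  refine concaveOn_of_hasDerivWithinAt2_nonpos hJc.convex (f' := fun t ↦ θ t / 2 * ρ t)
    (f'' := fun t ↦ F.raychaudhuri (γ t) / 2 * ρ t + θ t / 2 * (θ t / 2 * ρ t)) ?_ ?_ ?_ ?_
  · exact fun t ht ↦ (hρ t ht).continuousAt.continuousWithinAt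
  · intro t ht
    rw [hJ.interior_eq] at ht ⊢
    exact (hρ t ht).hasDerivWithinAt
  · intro t ht
    rw [hJ.interior_eq] at ht ⊢
    exact (hρ' t ht).hasDerivWithinAt
  · intro t ht
    rw [hJ.interior_eq] at ht
    have hρpos : 0 < ρ t := Real.exp_pos _
    have hr : F.raychaudhuri (γ t) = -(θ t) ^ 2 / 2 - (F.shearNormSq (γ t) + F.ricciField (γ t)) := by
      simp only [raychaudhuri, hκ t ht, hE', hθdef]
      ring
    have hcalc : F.raychaudhuri (γ t) / 2 * ρ t + θ t / 2 * (θ t / 2 * ρ t) =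
        -(ρ t * (F.shearNormSq (γ t) + F.ricciField (γ t))) / 2 := by
      rw [hr]
      ring
    show F.raychaudhuri (γ t) / 2 * ρ t + θ t / 2 * (θ t / 2 * ρ t) ≤ 0
    rw [hcalc]
    have := mul_nonneg hρpos.le (hnec t ht)
    linarith

/-! #### Time orientation, flow lines -/

/-- The generator field is **future-directed** with respect to the time orientation `τ` at the
points of `𝒩` (Galloway's and Gourgoulhon–Jaramillo's standing convention). [cite: Galloway2000, §2.1] -/
def IsFutureDirected (τ : TimeOrientation g) : Prop :=
  ∀ x ∈ 𝒩.carrier, τ.IsFutureDirected (F.field x)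

variable {F}

/-- Along a flow line on an open parameter set the velocity is the generator field:
`γ'(t) = n(γ t)`. [folklore] -/
lemma IsFlowLineOn.velocity_eq {γ : ℝ → M} {s : Set ℝ} (h : F.IsFlowLineOn γ s) (hs : IsOpen s)
    {t : ℝ} (ht : t ∈ s) : velocity I γ t = F.field (γ t) := by
  have hd : HasMFDerivAt 𝓘(ℝ, ℝ) I γ t ((1 : ℝ →L[ℝ] ℝ).smulRight (F.field (γ t))) :=
    (h.1 t ht).hasMFDerivAt (hs.mem_nhds ht)
  rw [velocity, hd.mfderiv]
  exact one_smul ℝ (F.field (γ t))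

/-- A flow line lies on `𝒩`. [folklore] -/
lemma IsFlowLineOn.mem_carrier {γ : ℝ → M} {s : Set ℝ} (h : F.IsFlowLineOn γ s) {t : ℝ}
    (ht : t ∈ s) : γ t ∈ 𝒩.carrier :=
  h.2 t ht

/-- The velocity of a flow line (on an open parameter set) is null. [folklore] -/
lemma IsFlowLineOn.isNull_velocity {γ : ℝ → M} {s : Set ℝ} (h : F.IsFlowLineOn γ s)
    (hs : IsOpen s) {t : ℝ} (ht : t ∈ s) : g.IsNull (velocity I γ t) := by
  rw [h.velocity_eq hs ht]
  exact F.isNull_field (h.2 t ht)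

/-- Restriction of the parameter set of a flow line. [folklore] -/
lemma IsFlowLineOn.mono {γ : ℝ → M} {s s' : Set ℝ} (h : F.IsFlowLineOn γ s) (hs : s' ⊆ s) :
    F.IsFlowLineOn γ s' :=
  ⟨h.1.mono hs, fun t ht ↦ h.2 t (hs ht)⟩

/-- `SatisfiesRaychaudhuri` applied to a flow line. [folklore] -/
lemma SatisfiesRaychaudhuri.satisfiesRaychaudhuriOn (h : F.SatisfiesRaychaudhuri) {γ : ℝ → M}
    {s : Set ℝ} (hs : IsOpen s) (hγ : F.IsFlowLineOn γ s) : F.SatisfiesRaychaudhuriOn γ s :=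
  h γ s hs hγ

/-- **Affinely scaled flow lines are generators.** If `γ` is a flow line of the generator field
on the open parameter set `s` along which the inaffinity vanishes (`κ ∘ γ = 0` on `s`), then `γ`
is a (geodesic) generator of `𝒩` on `s`: near each `t ∈ s` the tangent lift of `γ` is the lift of
`n ∘ γ` (`velocity_eq`), so `γ` is twice differentiable and `D(γ')/dt = D(n ∘ γ)/dt = ∇_{γ'} n =
∇_n n = κ n = 0` (O'Neill 1983, Ch. 3, Prop. 3.18 (3), the tree's `covariantDerivAlong_comp_holds`).
Gourgoulhon–Jaramillo 2006, §2.5 ("by a suitable choice of the renormalization … `∇_{ℓ'} ℓ' = 0`: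
the field lines of `ℓ` are null geodesics, the null generators of `𝓗`").
[cite: GourgoulhonJaramillo2006, §2.5] -/
theorem IsFlowLineOn.isGeneratorOn {γ : ℝ → M} {s : Set ℝ} (h : F.IsFlowLineOn γ s)
    (hs : IsOpen s) (hκ : ∀ t ∈ s, F.inaffinity (γ t) = 0) : 𝒩.IsGeneratorOn γ s := by
  have hγd : ∀ t ∈ s, HasMFDerivAt 𝓘(ℝ, ℝ) I γ t ((1 : ℝ →L[ℝ] ℝ).smulRight (F.field (γ t))) :=
    fun t ht ↦ (h.1 t ht).hasMFDerivAt (hs.mem_nhds ht)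
  -- near every `t ∈ s` the tangent lift of `γ` is the lift of `n ∘ γ`
  have hlift : ∀ t ∈ s, (tangentLift I γ) =ᶠ[𝓝 t]
      fun t ↦ (TotalSpace.mk' E (γ t) (F.field (γ t)) : TangentBundle I M) := fun t ht ↦ by
    filter_upwards [hs.mem_nhds ht] with t' ht'
    simp only [tangentLift, h.velocity_eq hs ht']
  refine ⟨⟨fun t ht ↦ ?_, fun t ht ↦ ?_⟩, fun t ht ↦ ⟨h.2 t ht, fun w ↦ ?_⟩⟩
  · exact ((F.mdifferentiableAt_field (h.2 t ht)).comp t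
      (hγd t ht).mdifferentiableAt).congr_of_eventuallyEq (hlift t ht)
  · rw [covariantDerivAlong_congr_of_eventuallyEq g.leviCivita (γ := γ) (γ' := γ)
        (W := fun t ↦ F.field (γ t)) (W' := fun t ↦ velocity I γ t) (hlift t ht),
      covariantDerivAlong_comp_holds g.leviCivita (hγd t ht).mdifferentiableAt
        (F.mdifferentiableAt_field (h.2 t ht)),
      h.velocity_eq hs ht, F.leviCivita_field_field _ (h.2 t ht), hκ t ht, zero_smul]
  · rw [h.velocity_eq hs ht]
    exact F.ker_iff _ (h.2 t ht) w

variable (F)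

/-! #### Rescaling the generator field -/

/-- **Rescaling of a generator field.** For a function `f`, `C¹` and nonvanishing at the points of
`𝒩`, `f n` is again a generator field, with inaffinity `κ' = f κ + n(f)` (`∇_{fn}(fn) =
f (f ∇_n n + (n f) n) = (f κ + n f) · (f n)`); positivity of `f` (preservation of the orientation)
is not needed for the kinematics and not required. Gourgoulhon–Jaramillo 2006, §2.5, scaling law
`ℓ → ℓ' = α ℓ ⟹ κ' = α(κ + ∇_ℓ ln α)`; Galloway 2000, §2.1 (`K̃ = f K`). The Leibniz rule of the
covariant derivative is Mathlib's `IsCovariantDerivativeOn.leibniz`.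
[cite: GourgoulhonJaramillo2006, §2.5] -/
def smul (f : M → ℝ) (hf : ∀ x ∈ 𝒩.carrier, ContMDiffAt I 𝓘(ℝ, ℝ) 1 f x)
    (hf0 : ∀ x ∈ 𝒩.carrier, f x ≠ 0) : 𝒩.GeneratorField where
  field := f • F.field
  inaffinity x := f x * F.inaffinity x + mvfderiv I f x (F.field x)
  contMDiffAt_field x hx := (hf x hx).smul_section (F.contMDiffAt_field x hx)
  ker_iff x hx w := by
    simp [F.ker_iff x hx w, Pi.smul_apply', hf0 x hx]
  val_leviCivita_field x hx w := by
    have hleib := g.leviCivita.isCovariantDerivativeOn.leibniz (F.mdifferentiableAt_field hx)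
      ((hf x hx).mdifferentiableAt one_ne_zero) (hx := Set.mem_univ x)
    have h1 := F.val_leviCivita_field x hx w
    have h2 := F.val_field_field hx
    rw [hleib]
    simp [Pi.smul_apply', h1, h2]
  leviCivita_field_field x hx := by
    have hleib := g.leviCivita.isCovariantDerivativeOn.leibniz (F.mdifferentiableAt_field hx)
      ((hf x hx).mdifferentiableAt one_ne_zero) (hx := Set.mem_univ x)
    have h3 := F.leviCivita_field_field x hx
    rw [Pi.smul_apply', map_smul, hleib]
    simp only [add_apply, smul_apply, ContinuousLinearMap.smulRight_apply, h3, smul_smul]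
    module

/-- The field of the rescaled generator field is `f n`. [folklore] -/
@[simp]
lemma smul_field (f : M → ℝ) (hf : ∀ x ∈ 𝒩.carrier, ContMDiffAt I 𝓘(ℝ, ℝ) 1 f x)
    (hf0 : ∀ x ∈ 𝒩.carrier, f x ≠ 0) (x : M) : (F.smul f hf hf0).field x = f x • F.field x :=
  rfl

/-- **Scaling law of the inaffinity**: `κ_{fn} = f κ_n + n(f)` (`n(f) = df(n)`, Mathlib's
`mvfderiv`, the differential of the real function `f` read in `ℝ`). Gourgoulhon–Jaramillo 2006,
§2.5. [cite: GourgoulhonJaramillo2006, §2.5] -/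
@[simp]
lemma smul_inaffinity (f : M → ℝ) (hf : ∀ x ∈ 𝒩.carrier, ContMDiffAt I 𝓘(ℝ, ℝ) 1 f x)
    (hf0 : ∀ x ∈ 𝒩.carrier, f x ≠ 0) (x : M) :
    (F.smul f hf hf0).inaffinity x = f x * F.inaffinity x + mvfderiv I f x (F.field x) :=
  rfl

/-- **Scaling law of the expansion**: `θ_{fn} = f θ_n` on `𝒩` — `div (f n) = f div n + n(f)`
(Leibniz rule and `tr (df ⊗ n) = df(n)`) while `κ_{fn} = f κ + n(f)`, the `n(f)` terms cancelling.
Galloway 2000, §2.1 ("if `K̃ = fK` then `θ̃ = fθ`"); Gourgoulhon–Jaramillo 2006, Remark 5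
(`Θ' = α Θ`). [cite: Galloway2000, §2.1] -/
theorem smul_expansion (f : M → ℝ) (hf : ∀ x ∈ 𝒩.carrier, ContMDiffAt I 𝓘(ℝ, ℝ) 1 f x)
    (hf0 : ∀ x ∈ 𝒩.carrier, f x ≠ 0) {x : M} (hx : x ∈ 𝒩.carrier) :
    (F.smul f hf hf0).expansion x = f x * F.expansion x := by
  have hleib := g.leviCivita.isCovariantDerivativeOn.leibniz (F.mdifferentiableAt_field hx)
    ((hf x hx).mdifferentiableAt one_ne_zero) (hx := Set.mem_univ x)
  have hsr : (((mvfderiv I f x).smulRight (F.field x) : TangentSpace I x →L[ℝ] TangentSpace I x) :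
      TangentSpace I x →ₗ[ℝ] TangentSpace I x) =
        ((mvfderiv I f x : TangentSpace I x →L[ℝ] ℝ) : TangentSpace I x →ₗ[ℝ] ℝ).smulRight
          (F.field x) :=
    LinearMap.ext fun _ ↦ rfl
  have hdiv : g.divVector (f • F.field) x =
      f x * g.divVector F.field x + mvfderiv I f x (F.field x) := by
    haveI : FiniteDimensional ℝ (TangentSpace I x) := inferInstanceAs (FiniteDimensional ℝ E)
    simp only [PseudoRiemannianMetric.divVector]
    rw [hleib, ContinuousLinearMap.toLinearMap_add, map_add, ContinuousLinearMap.toLinearMap_smul,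
      map_smul, hsr, LinearMap.trace_smulRight, smul_eq_mul]
    rfl
  simp only [expansion]
  rw [show (F.smul f hf hf0).field = f • F.field from rfl, hdiv, smul_inaffinity]
  ring

variable {F} in
/-- Rescaling by a positive function preserves future-directedness. [folklore] -/
lemma IsFutureDirected.smul {τ : TimeOrientation g} (h : F.IsFutureDirected τ) (f : M → ℝ)
    (hf : ∀ x ∈ 𝒩.carrier, ContMDiffAt I 𝓘(ℝ, ℝ) 1 f x) (hpos : ∀ x ∈ 𝒩.carrier, 0 < f x) :
    (F.smul f hf fun x hx ↦ (hpos x hx).ne').IsFutureDirected τ :=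
  fun x hx ↦ (h x hx).smul (hpos x hx)

/-- **Constant rescaling** `c n` (`c ≠ 0`) of a generator field: inaffinity `c κ`
(`constSMul_inaffinity`), expansion `c θ` (`constSMul_expansion`) — a change of the (non-affine)
parameter along the generators by the constant factor `c⁻¹`. Galloway 2000, §2.1.
[cite: Galloway2000, §2.1] -/
abbrev constSMul (c : ℝ) (hc : c ≠ 0) : 𝒩.GeneratorField :=
  F.smul (fun _ ↦ c) (fun _ _ ↦ contMDiffAt_const) fun _ _ ↦ hc

/-- `κ_{cn} = c κ_n`. Gourgoulhon–Jaramillo 2006, §2.5. [cite: GourgoulhonJaramillo2006, §2.5] -/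
@[simp]
lemma constSMul_inaffinity (c : ℝ) (hc : c ≠ 0) (x : M) :
    (F.constSMul c hc).inaffinity x = c * F.inaffinity x := by
  simp [constSMul, mvfderiv_const]

/-- `θ_{cn} = c θ_n` on `𝒩`. Galloway 2000, §2.1. [cite: Galloway2000, §2.1] -/
lemma constSMul_expansion (c : ℝ) (hc : c ≠ 0) {x : M} (hx : x ∈ 𝒩.carrier) :
    (F.constSMul c hc).expansion x = c * F.expansion x :=
  F.smul_expansion _ _ _ hx

end GeneratorField

/-! #### Homothetic images -/

/-- **The image of a level-set null hypersurface under a homothety is a level-set null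
hypersurface.** For a `C^∞` diffeomorphism `Φ` with `Φ^* g = e^{2s} g` (`IsHomothety`), the level
set of `v ∘ Φ⁻¹` is `Φ(𝒩)` (`carrier_map`), and at `Φ x` the kernel of `d(v ∘ Φ⁻¹)` is
`dΦ(ker dv_x) = dΦ(L^⊥) = (dΦ L)^⊥` with `dΦ L` null, since `dΦ` is a linear isomorphism scaling
all scalar products by `e^{2s}` (O'Neill 1983, Ch. 3, Remark 3.65: homotheties preserve causal
character). With it, `Φ` carries generators to generators with the same affine parameter and a
generator field `n` to `Φ_* n` with `κ`, `θ`, `|σ|²`, `Ric(n,n)` transported unchanged (a homothety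
is an isometry of `e^{2s} g`, which has the same Levi-Civita connection as `g`); these transport
statements need the naturality of the Levi-Civita connection and are not formalised here.
[cite: ONeill1983, Ch. 3, Remark 3.65] -/
def map (Φ : Diffeomorph I I M M ∞) {s : ℝ} (hΦ : g.IsHomothety s Φ) : g.NullLevelSet where
  fn := 𝒩.fn ∘ Φ.symm
  contMDiffAt_fn x hx := (𝒩.contMDiffAt_fn (Φ.symm x) hx).comp x Φ.symm.contMDiffAt
  exists_isNull x hx := by
    -- write `x = Φ y`
    obtain ⟨y, rfl⟩ : ∃ y, Φ y = x := ⟨Φ.symm x, Φ.apply_symm_apply x⟩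
    have hy : 𝒩.fn y = 0 := by simpa using hx
    obtain ⟨L, hL, hker⟩ := 𝒩.exists_isNull y hy
    -- `dΦ_y` as a linear isomorphism `T_y M ≃ T_{Φ y} M`
    have he : ∀ u : TangentSpace I y,
        Φ.mfderivToContinuousLinearEquiv (by simp) y u = mfderiv I I Φ y u := fun _ ↦ rfl
    -- chain rule along `(v ∘ Φ⁻¹) ∘ Φ = v`: `dv_y u = d(v ∘ Φ⁻¹)_{Φ y} (dΦ_y u)`
    have hd : MDifferentiableAt I 𝓘(ℝ, ℝ) (𝒩.fn ∘ Φ.symm) (Φ y) :=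
      ((𝒩.contMDiffAt_fn (Φ.symm (Φ y)) hx).comp (Φ y) Φ.symm.contMDiffAt).mdifferentiableAt
        (by simp)
    have hchain : ∀ u : TangentSpace I y, mfderiv I 𝓘(ℝ, ℝ) 𝒩.fn y u =
        mfderiv I 𝓘(ℝ, ℝ) (𝒩.fn ∘ Φ.symm) (Φ y) (mfderiv I I Φ y u) := fun u ↦ by
      have hc := mfderiv_comp y hd (Φ.mdifferentiable (by simp) y)
      rw [show (𝒩.fn ∘ Φ.symm) ∘ Φ = 𝒩.fn from funext fun z ↦ by simp] at hc
      exact DFunLike.congr_fun hc u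
    refine ⟨mfderiv I I Φ y L, ⟨?_, fun h0 ↦ hL.2 ?_⟩, fun w ↦ ?_⟩
    · rw [hΦ.val_mfderiv, hL.1, mul_zero]
    · rw [← he] at h0
      exact (ContinuousLinearEquiv.map_eq_zero_iff _).mp h0
    · obtain ⟨u, rfl⟩ := (Φ.mfderivToContinuousLinearEquiv (by simp) y).surjective w
      rw [he u, ← hchain u]
      refine (hker u).trans ?_
      rw [hΦ.val_mfderiv, mul_eq_zero, or_iff_right (Real.exp_pos _).ne']

omit [FiniteDimensional ℝ E] [CompleteSpace E] [Fact (1 ≤ n)] in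
/-- The level-set function of the image is `v ∘ Φ⁻¹`. [folklore] -/
@[simp]
lemma map_fn (Φ : Diffeomorph I I M M ∞) {s : ℝ} (hΦ : g.IsHomothety s Φ) :
    (𝒩.map Φ hΦ).fn = 𝒩.fn ∘ Φ.symm :=
  rfl

omit [FiniteDimensional ℝ E] [CompleteSpace E] [Fact (1 ≤ n)] in
/-- The image hypersurface is `Φ(𝒩)`. [folklore] -/
lemma carrier_map (Φ : Diffeomorph I I M M ∞) {s : ℝ} (hΦ : g.IsHomothety s Φ) :
    (𝒩.map Φ hΦ).carrier = Φ '' 𝒩.carrier := by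
  ext x
  simp only [mem_carrier_iff, map_fn, Function.comp_apply, Set.mem_image]
  constructor
  · intro hx
    exact ⟨Φ.symm x, hx, Φ.apply_symm_apply x⟩
  · rintro ⟨y, hy, rfl⟩
    simpa using hy

end NullLevelSet

/-- **Null cone generator kinematics** — the datum over which the kinematics of this file is
read: a null hypersurface of `(M, g)` presented as a regular level set (`NullLevelSet`: e.g. a null
cone `{v = 0}`) together with a generator field on it (`NullLevelSet.GeneratorField`: the null
generator `n` with its inaffinity `κ`), giving at each point of the hypersurface the Weingarten map
`∇n`, the null second fundamental form `B`, the expansion `θ = div n - κ`, the squared shear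
`|σ|²`, `Ric(n, n)`, and along its flow lines the Raychaudhuri identity and the Jacobi area
density (dot notation through `generatorField`). Galloway 2000, §2.1; Gourgoulhon–Jaramillo 2006,
§2.5–2.7, §5.6, §6.2. [cite: Galloway2000, §2.1] -/
structure NullConeGeneratorKinematics (g : LorentzianMetric I n M) [Fact (1 ≤ n)] where
  /-- The null hypersurface, as a regular level set. -/
  hypersurface : g.NullLevelSet
  /-- The generator field with its inaffinity. -/
  generatorField : hypersurface.GeneratorField

namespace NullConeGeneratorKinematics

variable {g : LorentzianMetric I n M} [Fact (1 ≤ n)] (K : g.NullConeGeneratorKinematics)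

/-- The underlying subset of `M`. [folklore] -/
abbrev carrier : Set M := K.hypersurface.carrier

/-- The expansion `θ` of the datum at `x` (`GeneratorField.expansion`). [folklore] -/
abbrev expansion (x : M) : ℝ := K.generatorField.expansion x

/-- The inaffinity `κ` of the datum at `x`. [folklore] -/
abbrev inaffinity (x : M) : ℝ := K.generatorField.inaffinity x

/-- The squared shear `|σ|²` of the datum at `x` (`GeneratorField.shearNormSq`). [folklore] -/
abbrev shearNormSq (x : M) : ℝ := K.generatorField.shearNormSq x

end NullConeGeneratorKinematics

end LorentzianMetric

/-! ### The vertex past cone of a self-similar vacuum profile -/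

namespace SelfSimilarVacuumProfile

variable {n : ℕ∞ω} [Fact (1 ≤ n)]

/-- The **vertex past cone `{v = 0}` of a self-similar vacuum profile as a level-set null
hypersurface** (its optical function `coneFn`, smoothness `contMDiffAt_coneFn` and null-kernel axiom
`exists_isNull_of_coneFn_eq_zero` are exactly the fields of `NullLevelSet`), so that generators,
generator fields, expansion, shear, inaffinity, the Raychaudhuri identity and the Jacobi area
density apply to `Z.cone` (`coneLevelSet_carrier`). Rodnianski–Shlapentokh-Rothman 2023, Thm. 1
(the cone `{v̂ = 0}`). [cite: RodnianskiShlapentokhRothman2023, Thm. 1] -/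
def coneLevelSet (Z : SelfSimilarVacuumProfile n) : Z.metric.NullLevelSet where
  fn := Z.coneFn
  contMDiffAt_fn := Z.contMDiffAt_coneFn
  exists_isNull := Z.exists_isNull_of_coneFn_eq_zero

/-- The level-set function of the cone is the optical function `v`. [folklore] -/
@[simp] lemma coneLevelSet_fn (Z : SelfSimilarVacuumProfile n) : Z.coneLevelSet.fn = Z.coneFn := rfl

/-- The carrier of the cone level set is the vertex past cone `Z.cone`. [folklore] -/
@[simp] lemma coneLevelSet_carrier (Z : SelfSimilarVacuumProfile n) :
    Z.coneLevelSet.carrier = Z.cone := rfl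

/-- The generator kinematics datum of the vertex past cone of a profile with a chosen generator
field `F` on it. [folklore] -/
abbrev coneKinematics (Z : SelfSimilarVacuumProfile n) (F : Z.coneLevelSet.GeneratorField) :
    Z.metric.NullConeGeneratorKinematics :=
  ⟨Z.coneLevelSet, F⟩

/-- The image of the cone level set under the dilation `Φ` (a homothety of log-scale `Δ`) is
again a level-set null hypersurface, with carrier `Φ(Z.cone)`. [folklore] -/
lemma carrier_map_dilation (Z : SelfSimilarVacuumProfile n) :
    (Z.coneLevelSet.map Z.dilation Z.isHomothety_dilation).carrier = Z.dilation '' Z.cone :=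
  Z.coneLevelSet.carrier_map Z.dilation Z.isHomothety_dilation

end SelfSimilarVacuumProfile

end Literature.Geometry.Lorentzian

end
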